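import Literature.AlgebraicGeometry.HodgeTheory.ZariskiClosureRealPoints
import Literature.AlgebraicGeometry.HodgeTheory.GlZariskiClosureGroup
import HarnessLib

/-!
# From the complex Zariski closure of a UNITARY group back to the real Zariski closure of its real points
# (the unitary trick `ḡ = H g⁻¹ H⁻¹` on `U(h)`; Borel, *Linear Algebraic Groups*, AG §§11–14), and the
# closure of the unit scalars (Carlson–Toledo 1999 §7 — algebraic proof, part 5)

Family `hodge`, layer `Literature/AlgebraicGeometry/HodgeTheory`. THEOREMS only (no definition, no named
fact). Companion of `ZariskiClosureRealPoints` (Ax: membership of the real points in the REAL closure of the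
real points implies membership in the COMPLEX closure). This file proves the converse FOR UNITARY GROUPS, which
is what turns the complex-points density `SL(W) ⊆ (Γ^Zar)°(ℂ)` of `UnitaryReflectionLieClosure` into the
real-points conclusion "`U(W,h) ⊆ (Γ·U(1))^Zar(ℝ)`" of the named fact
`carlsonToledo1999_unitaryReflection_zariskiDense` (`UnitaryReflectionGroupZariskiDense`):

* `restrictScalarsRealHom_mem_glZariskiClosure_of_unitary` — for a non-degenerate sesquilinear form `B` on
  the finite-dimensional complex `W`, a subgroup `Δ ≤ GL_ℂ(W)` of `B`-unitary automorphisms and a `B`-unitary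
  `u` in the COMPLEX closure `glZariskiClosure Δ`, the real points `restrictScalarsRealHom W u` lie in the
  REAL closure of the real points `Δ.map (restrictScalarsRealHom W)`. Proof: a real polynomial `P` in the
  real matrix entries (real basis `br`) is, on complex-linear maps, a complex polynomial in the complex
  entries `g_{kl}` (complex basis `b`) AND their conjugates (`Re z = (z + z̄)/2`, `Im z = (z - z̄)/2i`; the
  real entries are `ℝ`-linear in `(Re g_{kl}, Im g_{kl})`); on `B`-unitary `g` the Gram identity
  `ḡᵀ H g = H` (`H_{pq} = B(b_p, b_q)`, invertible by non-degeneracy) gives `ḡ_{kl} = (H g⁻¹ H⁻¹)_{lk}`, a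
  polynomial in the entries of `g` and `1/det g`; clearing denominators
  (`GlZariskiClosureGroup.evalAtInvDet_eq_zero_of_mem`) the relation `P = 0` on `Δ` persists at `u`.
* `mem_glZariskiClosure_of_forall_apply_eq_smul` — if `Δ` contains the unit scalars `z·1`, `|z| = 1`, its
  complex closure contains EVERY non-zero scalar `c·1` (a polynomial in one variable vanishing on the
  infinite unit circle vanishes).

Written by the prover seat `hodge-nonav-prover-Bx` (cell `hodge-nonav`) for the discharge of
Carlson–Toledo's density theorem (crux K1 of `Summits/HodgeConjecture/HodgeConjecture/Theses/CyclicUnitaryPowers.lean`).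

## References
* [Borel1991] A. Borel, *Linear Algebraic Groups*, 2nd ed., GTM 126 (1991), AG §11.4, §12.4, §14.1–14.2
  (restriction of the ground field, `k`-structures), I.1.7 (`GL_n = D(det)`).
* [CarlsonToledo1999] J. A. Carlson, D. Toledo, Duke Math. J. 97 (1999), §7 Theorem `udensitytheo` (the
  real algebraic group `PU(p,q)` in which density is asserted).
-/

noncomputable section

open Module Literature.AlgebraicGeometry.Motives
open scoped ComplexConjugate Matrix

namespace Literature.AlgebraicGeometry.HodgeTheory

variable {W : Type} [AddCommGroup W] [Module ℂ W] [FiniteDimensional ℂ W]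

/-! ### §1 The complex closure of the unit scalars contains all scalars -/

/-- The unit circle of `ℂ` is infinite (it contains primitive roots of unity of every order). [folklore] -/
private theorem infinite_setOf_norm_eq_one : {z : ℂ | ‖z‖ = 1}.Infinite := by
  refine Set.infinite_of_injective_forall_mem (f := fun n : ℕ => Complex.exp (2 * Real.pi * Complex.I / (n + 1 : ℕ)))
    (fun n m h => ?_) (fun n => ?_)
  · have hn := Complex.isPrimitiveRoot_exp (n + 1) (Nat.succ_ne_zero n)
    have hm := Complex.isPrimitiveRoot_exp (m + 1) (Nat.succ_ne_zero m)
    simp only at h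
    rw [h] at hn
    exact Nat.succ_injective (hn.unique hm)
  · exact Complex.norm_eq_one_of_pow_eq_one
      (Complex.isPrimitiveRoot_exp (n + 1) (Nat.succ_ne_zero n)).pow_eq_one (Nat.succ_ne_zero n)

/-- **The complex Zariski closure of a subgroup containing the unit scalars contains every non-zero scalar**:
if for every `z` with `|z| = 1` some element of `Δ` acts as `z·1`, then every `g` acting as `c·1`, `c ≠ 0`,
lies in `glZariskiClosure Δ` (a polynomial in the entries restricted to the scalars is a polynomial in one
variable vanishing on the unit circle, hence zero). [cite: Borel1991, I.2.1] -/
theorem mem_glZariskiClosure_of_forall_apply_eq_smul {Δ : Subgroup (W ≃ₗ[ℂ] W)}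
    (hΔ : ∀ z : ℂ, ‖z‖ = 1 → ∃ g ∈ Δ, ∀ x, g x = z • x) {c : ℂ} {g : W ≃ₗ[ℂ] W}
    (hg : ∀ x, g x = c • x) : g ∈ glZariskiClosure Δ := by
  classical
  let b := Module.Free.chooseBasis ℂ W
  rw [mem_glZariskiClosure_iff, ← zariskiClosureEnd_basis_indep b, mem_zariskiClosureEndOfBasis_iff]
  intro P hP
  -- matrices of scalars
  have hmat : ∀ (f : W ≃ₗ[ℂ] W) (z : ℂ), (∀ x, f x = z • x) → ∀ ij : _ × _,
      LinearMap.toMatrix b b (f : W →ₗ[ℂ] W) ij.1 ij.2 = if ij.1 = ij.2 then z else 0 := by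
    intro f z hf ij
    rw [LinearMap.toMatrix_apply, LinearEquiv.coe_coe, hf, map_smul, b.repr_self, Finsupp.smul_apply,
      Finsupp.single_apply, smul_eq_mul, mul_ite, mul_one, mul_zero]
    simp only [eq_comm]
  -- the one-variable polynomial `q(t) = P(t·1)`
  let q : Polynomial ℂ := MvPolynomial.aeval (fun ij : _ × _ => if ij.1 = ij.2 then Polynomial.X else 0) P
  have hq : ∀ z : ℂ, q.eval z = MvPolynomial.eval (fun ij : _ × _ => if ij.1 = ij.2 then z else 0) P := by
    intro z
    change Polynomial.aeval z (MvPolynomial.aeval _ P) = _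
    rw [← AlgHom.comp_apply, MvPolynomial.comp_aeval, MvPolynomial.aeval_eq_eval₂Hom]
    change MvPolynomial.eval _ P = _
    refine congrArg (fun v => MvPolynomial.eval v P) (funext fun ij => ?_)
    split_ifs <;> simp
  have hroots : {z : ℂ | ‖z‖ = 1} ⊆ {z : ℂ | q.IsRoot z} := by
    intro z hz
    obtain ⟨f, hfΔ, hf⟩ := hΔ z hz
    rw [Set.mem_setOf_eq, Polynomial.IsRoot.def, hq]
    have h := hP _ ⟨f, hfΔ, rfl⟩
    rwa [show (fun ij : _ × _ => LinearMap.toMatrix b b (f : Module.End ℂ W) ij.1 ij.2) =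
      fun ij => if ij.1 = ij.2 then z else 0 from funext (hmat f z hf)] at h
  have hq0 : q = 0 := Polynomial.eq_zero_of_infinite_isRoot q (infinite_setOf_norm_eq_one.mono hroots)
  rw [show (fun ij : _ × _ => LinearMap.toMatrix b b (g : Module.End ℂ W) ij.1 ij.2) =
      fun ij => if ij.1 = ij.2 then c else 0 from funext (hmat g c hg), ← hq, hq0, Polynomial.eval_zero]

/-! ### §2 The Gram matrix of a non-degenerate sesquilinear form and the unitary identity `ḡ = H g⁻¹ H⁻¹` -/

section Gram

variable {ι : Type*} [Fintype ι] [DecidableEq ι]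

omit [FiniteDimensional ℂ W] in
/-- **The Gram matrix `H_{pq} = B(b_p, b_q)` of a right-separating sesquilinear form is invertible.**
[cite: Borel1991, AG §14.2] -/
theorem det_gramSesq_ne_zero {B : W →ₗ⋆[ℂ] W →ₗ[ℂ] ℂ} (hBr : B.SeparatingRight) (b : Basis ι ℂ W) :
    (Matrix.of fun p q : ι => B (b p) (b q)).det ≠ 0 := by
  intro hdet
  obtain ⟨v, hv0, hv⟩ := Matrix.exists_mulVec_eq_zero_iff.2 hdet
  set y : W := ∑ q, v q • b q with hy
  have hy0 : y ≠ 0 := by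
    intro h
    apply hv0
    have : b.equivFun.symm v = b.equivFun.symm 0 := by rw [Basis.equivFun_symm_apply, map_zero]; exact h
    exact b.equivFun.symm.injective this
  have hBy : ∀ p, B (b p) y = 0 := by
    intro p
    have h := congrFun hv p
    simp only [Matrix.mulVec, dotProduct, Matrix.of_apply, Pi.zero_apply] at h
    rw [hy, map_sum]
    simpa [map_smul, smul_eq_mul, mul_comm] using h
  clear_value y
  apply hy0
  refine hBr y fun x => ?_
  rw [← b.sum_repr x, map_sum, LinearMap.sum_apply]
  exact Finset.sum_eq_zero fun p _ => by rw [LinearMap.map_smulₛₗ, LinearMap.smul_apply, hBy p, smul_zero]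

omit [FiniteDimensional ℂ W] in
/-- **The Gram identity of a unitary map**: `[g]ᴴ H [g] = H` for `B(gx, gy) = B(x, y)`, `H_{pq} = B(b_p, b_q)`.
[cite: Borel1991, AG §14.2] -/
theorem conjTranspose_mul_gram_mul {B : W →ₗ⋆[ℂ] W →ₗ[ℂ] ℂ} (b : Basis ι ℂ W) {g : W →ₗ[ℂ] W}
    (hg : ∀ x y, B (g x) (g y) = B x y) :
    (LinearMap.toMatrix b b g)ᴴ * (Matrix.of fun p q : ι => B (b p) (b q)) * LinearMap.toMatrix b b g =
      Matrix.of fun p q : ι => B (b p) (b q) := by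
  ext i j
  have hcol : ∀ i, g (b i) = ∑ p, LinearMap.toMatrix b b g p i • b p := fun i => by
    conv_lhs => rw [← Matrix.toLin_toMatrix b b g]
    rw [Matrix.toLin_self]
  have hA : ∀ (c : ι → ℂ) (y : W), B (∑ p, c p • b p) y = ∑ p, conj (c p) * B (b p) y := by
    intro c y
    rw [map_sum, LinearMap.sum_apply]
    simp only [LinearMap.map_smulₛₗ, LinearMap.smul_apply, smul_eq_mul]
  have hB' : ∀ (d : ι → ℂ) (x : W), B x (∑ q, d q • b q) = ∑ q, d q * B x (b q) := by
    intro d x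
    rw [map_sum]
    simp only [map_smul, smul_eq_mul]
  have h := hg (b i) (b j)
  rw [hcol i, hcol j, hA] at h
  simp only [hB', Finset.mul_sum] at h
  rw [Matrix.of_apply, ← h, Matrix.mul_apply]
  simp only [Matrix.mul_apply, Matrix.conjTranspose_apply, Matrix.of_apply, Finset.sum_mul]
  rw [Finset.sum_comm]
  refine Finset.sum_congr rfl fun p _ => Finset.sum_congr rfl fun q _ => ?_
  rw [Complex.star_def]
  ring

omit [FiniteDimensional ℂ W] in
/-- **On a unitary map, the conjugate entries are rational in the entries**: `conj [g]_{kl} = (H [g]⁻¹ H⁻¹)_{lk}`.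
[cite: Borel1991, AG §14.2] -/
theorem star_toMatrix_apply_of_unitary {B : W →ₗ⋆[ℂ] W →ₗ[ℂ] ℂ} (hBr : B.SeparatingRight) (b : Basis ι ℂ W)
    {g : W ≃ₗ[ℂ] W} (hg : ∀ x y, B (g x) (g y) = B x y) (k l : ι) :
    conj (LinearMap.toMatrix b b (g : W →ₗ[ℂ] W) k l) =
      ((Matrix.of fun p q : ι => B (b p) (b q)) * (LinearMap.toMatrix b b (g : W →ₗ[ℂ] W))⁻¹ *
        (Matrix.of fun p q : ι => B (b p) (b q))⁻¹) l k := by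
  set G := LinearMap.toMatrix b b (g : W →ₗ[ℂ] W) with hG
  set H := (Matrix.of fun p q : ι => B (b p) (b q)) with hH
  have hGdet : IsUnit G.det := by
    rw [hG, LinearMap.det_toMatrix, ← LinearEquiv.coe_det]; exact Units.isUnit _
  have hHdet : IsUnit H.det := (Ne.isUnit (det_gramSesq_ne_zero hBr b))
  have h1 : Gᴴ * H * G = H := conjTranspose_mul_gram_mul b hg
  have h2 : Gᴴ = H * G⁻¹ * H⁻¹ := by
    calc Gᴴ = Gᴴ * H * G * G⁻¹ * H⁻¹ := by
          rw [Matrix.mul_assoc (Gᴴ * H), Matrix.mul_nonsing_inv G hGdet, Matrix.mul_one, Matrix.mul_assoc,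
            Matrix.mul_nonsing_inv H hHdet, Matrix.mul_one]
      _ = H * G⁻¹ * H⁻¹ := by rw [h1]
  rw [← Complex.star_def, ← Matrix.conjTranspose_apply, h2]

end Gram

/-! ### §3 The real matrix of a complex-linear map is `ℝ`-linear in (real and imaginary parts of) its
complex matrix -/

section RealEntries

variable {ι κ : Type*} [Fintype ι] [DecidableEq ι] [Fintype κ] [DecidableEq κ]

omit [FiniteDimensional ℂ W] in
/-- The real matrix (real basis `br`) of the complex-linear map with complex matrix `F` (complex basis `b`):
an additive function of `F`. [cite: Borel1991, AG §12.4] -/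
private theorem realMatrix_add (b : Basis ι ℂ W) (br : Basis κ ℝ W) (F F' : Matrix ι ι ℂ) :
    LinearMap.toMatrix br br ((Matrix.toLin b b (F + F')).restrictScalars ℝ) =
      LinearMap.toMatrix br br ((Matrix.toLin b b F).restrictScalars ℝ) +
        LinearMap.toMatrix br br ((Matrix.toLin b b F').restrictScalars ℝ) := by
  rw [← map_add, map_add, LinearMap.restrictScalars_add]

omit [FiniteDimensional ℂ W] in
/-- … and `ℝ`-homogeneous. [cite: Borel1991, AG §12.4] -/
private theorem realMatrix_smul (b : Basis ι ℂ W) (br : Basis κ ℝ W) (t : ℝ) (F : Matrix ι ι ℂ) :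
    LinearMap.toMatrix br br ((Matrix.toLin b b ((t : ℂ) • F)).restrictScalars ℝ) =
      t • LinearMap.toMatrix br br ((Matrix.toLin b b F).restrictScalars ℝ) := by
  have h : (Matrix.toLin b b ((t : ℂ) • F)).restrictScalars ℝ = t • (Matrix.toLin b b F).restrictScalars ℝ := by
    ext x
    change (Matrix.toLin b b ((t : ℂ) • F)) x = t • (Matrix.toLin b b F) x
    rw [map_smul, LinearMap.smul_apply, Complex.coe_smul]
  rw [h, map_smul]

omit [FiniteDimensional ℂ W] in
/-- **The real entries are `ℝ`-linear in `(Re F_{kl}, Im F_{kl})`**: with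
`α_{ac,kl} = [E_{kl}]^ℝ_{ac}` and `β_{ac,kl} = [i E_{kl}]^ℝ_{ac}`,
`[F]^ℝ_{ac} = Σ_{kl} Re F_{kl} α_{ac,kl} + Im F_{kl} β_{ac,kl}`. [cite: Borel1991, AG §12.4] -/
theorem toMatrix_restrictScalars_eq_sum (b : Basis ι ℂ W) (br : Basis κ ℝ W) (F : Matrix ι ι ℂ) (a c : κ) :
    LinearMap.toMatrix br br ((Matrix.toLin b b F).restrictScalars ℝ) a c =
      ∑ k, ∑ l, ((F k l).re * LinearMap.toMatrix br br
          ((Matrix.toLin b b (Matrix.single k l (1 : ℂ))).restrictScalars ℝ) a c +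
        (F k l).im * LinearMap.toMatrix br br
          ((Matrix.toLin b b (Matrix.single k l Complex.I)).restrictScalars ℝ) a c) := by
  -- bundle the additive map
  let Λ : Matrix ι ι ℂ →+ Matrix κ κ ℝ :=
    { toFun := fun F => LinearMap.toMatrix br br ((Matrix.toLin b b F).restrictScalars ℝ)
      map_zero' := by simp
      map_add' := realMatrix_add b br }
  have hΛ : ∀ F, Λ F = LinearMap.toMatrix br br ((Matrix.toLin b b F).restrictScalars ℝ) := fun F => rfl
  have hΛs : ∀ (t : ℝ) F, Λ ((t : ℂ) • F) = t • Λ F := fun t F => realMatrix_smul b br t F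
  have hF : F = ∑ k, ∑ l, (((F k l).re : ℂ) • Matrix.single k l (1 : ℂ) +
      ((F k l).im : ℂ) • Matrix.single k l Complex.I) := by
    conv_lhs => rw [Matrix.matrix_eq_sum_single F]
    refine Finset.sum_congr rfl fun k _ => Finset.sum_congr rfl fun l _ => ?_
    rw [Matrix.smul_single, Matrix.smul_single, smul_eq_mul, mul_one, smul_eq_mul, ← Matrix.single_add,
      Complex.re_add_im]
  have key : Λ F = ∑ k, ∑ l, ((F k l).re • Λ (Matrix.single k l (1 : ℂ)) +
      (F k l).im • Λ (Matrix.single k l Complex.I)) := by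
    conv_lhs => rw [hF]
    rw [map_sum]
    refine Finset.sum_congr rfl fun k _ => ?_
    rw [map_sum]
    refine Finset.sum_congr rfl fun l _ => ?_
    rw [map_add, hΛs, hΛs]
  rw [← hΛ F, key, Matrix.sum_apply]
  refine Finset.sum_congr rfl fun k _ => ?_
  rw [Matrix.sum_apply]
  refine Finset.sum_congr rfl fun l _ => ?_
  rw [Matrix.add_apply, Matrix.smul_apply, Matrix.smul_apply, smul_eq_mul, smul_eq_mul, hΛ, hΛ]

end RealEntries

/-! ### §4 The transfer -/

section Transfer

variable {ι κ : Type*} [Fintype ι] [DecidableEq ι] [Fintype κ] [DecidableEq κ]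

omit [FiniteDimensional ℂ W] in
/-- **A real polynomial in the real entries is, on UNITARY maps, a rational function of the complex
entries**: for every real polynomial `P` in the `br`-entries there is `Q ∈ ℂ[x_{ij}][y]` (`y = 1/det x`) with
`Q([g]_b, 1/det [g]_b) = P([g]_{br})` for every `B`-unitary `g` (`Re z = (z + z̄)/2`, `Im z = (z - z̄)/2i`,
`ḡ = H g⁻¹ H⁻¹`). [cite: Borel1991, AG §12.4 and §14.2] -/
theorem exists_polynomial_evalAtInvDet_eq_of_unitary {B : W →ₗ⋆[ℂ] W →ₗ[ℂ] ℂ} (hBr : B.SeparatingRight)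
    (b : Basis ι ℂ W) (br : Basis κ ℝ W) (P : MvPolynomial (κ × κ) ℝ) :
    ∃ Q : Polynomial (MvPolynomial (ι × ι) ℂ), ∀ g : W ≃ₗ[ℂ] W, (∀ x y, B (g x) (g y) = B x y) →
      evalAtInvDet (LinearMap.toMatrix b b (g : W →ₗ[ℂ] W)) Q =
        ((MvPolynomial.eval (fun ac : κ × κ =>
          LinearMap.toMatrix br br ((g : W →ₗ[ℂ] W).restrictScalars ℝ) ac.1 ac.2) P : ℝ) : ℂ) := by
  classical
  set Hm : Matrix ι ι ℂ := Matrix.of fun p q : ι => B (b p) (b q) with hHm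
  let α : κ × κ → ι × ι → ℝ := fun ac kl =>
    LinearMap.toMatrix br br ((Matrix.toLin b b (Matrix.single kl.1 kl.2 (1 : ℂ))).restrictScalars ℝ) ac.1 ac.2
  let β : κ × κ → ι × ι → ℝ := fun ac kl =>
    LinearMap.toMatrix br br ((Matrix.toLin b b (Matrix.single kl.1 kl.2 Complex.I)).restrictScalars ℝ) ac.1 ac.2
  -- the polynomial expressions of the conjugate entries and of the real entries
  let conjP : ι × ι → Polynomial (MvPolynomial (ι × ι) ℂ) := fun kl =>
    (constMatrix Hm * genericInverse ι ℂ * constMatrix Hm⁻¹) kl.2 kl.1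
  let Cc : ℂ → Polynomial (MvPolynomial (ι × ι) ℂ) := fun z => Polynomial.C (MvPolynomial.C z)
  have hCc : ∀ (M : Matrix ι ι ℂ) (z : ℂ), evalAtInvDet M (Cc z) = z := fun M z => by
    simp only [Cc, evalAtInvDet_C, MvPolynomial.eval_C]
  let σ : κ × κ → Polynomial (MvPolynomial (ι × ι) ℂ) := fun ac =>
    ∑ kl : ι × ι, (Cc ((α ac kl : ℂ) / 2) * (genericMatrix ι ℂ kl.1 kl.2 + conjP kl) +
      Cc (-(β ac kl : ℂ) * Complex.I / 2) * (genericMatrix ι ℂ kl.1 kl.2 - conjP kl))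
  refine ⟨MvPolynomial.aeval σ (MvPolynomial.map Complex.ofRealHom P), fun g hg => ?_⟩
  set G := LinearMap.toMatrix b b (g : W →ₗ[ℂ] W) with hG
  have hconj : ∀ kl : ι × ι, evalAtInvDet G (conjP kl) = conj (G kl.1 kl.2) := by
    intro kl
    have hmat : (evalAtInvDet G).mapMatrix (constMatrix Hm * genericInverse ι ℂ * constMatrix Hm⁻¹) =
        Hm * G⁻¹ * Hm⁻¹ := by
      rw [map_mul, map_mul, mapMatrix_constMatrix, mapMatrix_genericInverse, mapMatrix_constMatrix]
    have h := congrArg (fun M : Matrix ι ι ℂ => M kl.2 kl.1) hmat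
    simp only [RingHom.mapMatrix_apply, Matrix.map_apply] at h
    rw [show conjP kl = (constMatrix Hm * genericInverse ι ℂ * constMatrix Hm⁻¹) kl.2 kl.1 from rfl, h,
      hHm, hG, ← star_toMatrix_apply_of_unitary hBr b hg kl.1 kl.2]
  have hgen : ∀ kl : ι × ι, evalAtInvDet G (genericMatrix ι ℂ kl.1 kl.2) = G kl.1 kl.2 := by
    intro kl
    have h := congrArg (fun M : Matrix ι ι ℂ => M kl.1 kl.2) (mapMatrix_genericMatrix G)
    simpa only [RingHom.mapMatrix_apply, Matrix.map_apply] using h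
  have hσ : ∀ ac : κ × κ, evalAtInvDet G (σ ac) =
      ((LinearMap.toMatrix br br ((g : W →ₗ[ℂ] W).restrictScalars ℝ) ac.1 ac.2 : ℝ) : ℂ) := by
    intro ac
    rw [show (g : W →ₗ[ℂ] W) = Matrix.toLin b b G by rw [hG, Matrix.toLin_toMatrix],
      toMatrix_restrictScalars_eq_sum b br G ac.1 ac.2]
    simp only [σ, map_sum, map_add, map_mul, map_sub, hCc, hgen, hconj]
    push_cast
    rw [Fintype.sum_prod_type]
    refine Finset.sum_congr rfl fun k _ => Finset.sum_congr rfl fun l _ => ?_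
    rw [Complex.add_conj, Complex.sub_conj]
    push_cast
    linear_combination (-((β ac (k, l) : ℝ) : ℂ) * ((G k l).im : ℂ)) * Complex.I_mul_I
  rw [evalAtInvDet_aeval]
  simp only [hσ]
  exact eval_ofReal_map_ofReal _ P

/-- **Unitary trick: from the COMPLEX closure to the REAL closure of the real points, for unitary groups.**
`B` non-degenerate sesquilinear on the finite-dimensional complex `W`; `Δ ≤ GL_ℂ(W)` consisting of
`B`-unitary maps; `u` `B`-unitary with `u ∈ glZariskiClosure Δ` (complex points). Then
`restrictScalarsRealHom W u ∈ glZariskiClosure (Δ.map (restrictScalarsRealHom W))` (real points): a real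
polynomial relation `P = 0` on the real points of `Δ` is a rational relation `Q(x, 1/det x) = 0` on the complex
matrices of `Δ` (`exists_polynomial_evalAtInvDet_eq_of_unitary`), which persists at `u` by clearing
denominators (`evalAtInvDet_eq_zero_of_mem`). [cite: Borel1991, AG §11.4, §12.4 and I.1.7] -/
theorem restrictScalarsRealHom_mem_glZariskiClosure_of_unitary {B : W →ₗ⋆[ℂ] W →ₗ[ℂ] ℂ}
    (hBn : B.Nondegenerate) {Δ : Subgroup (W ≃ₗ[ℂ] W)} (hΔ : ∀ g ∈ Δ, ∀ x y, B (g x) (g y) = B x y)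
    {u : W ≃ₗ[ℂ] W} (hu : ∀ x y, B (u x) (u y) = B x y) (hmem : u ∈ glZariskiClosure Δ) :
    restrictScalarsRealHom W u ∈ glZariskiClosure (Δ.map (restrictScalarsRealHom W)) := by
  classical
  let b := Module.finBasis ℂ W
  let br := Module.finBasis ℝ W
  rw [mem_glZariskiClosure_iff, ← zariskiClosureEnd_basis_indep b] at hmem
  rw [mem_glZariskiClosure_iff, ← zariskiClosureEnd_basis_indep br, mem_zariskiClosureEndOfBasis_iff]
  intro P hP
  obtain ⟨Q, hQ⟩ := exists_polynomial_evalAtInvDet_eq_of_unitary hBn.2 b br P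
  have hdetS : ∀ s ∈ (fun h : W ≃ₗ[ℂ] W => (h : Module.End ℂ W)) '' (Δ : Set (W ≃ₗ[ℂ] W)),
      (LinearMap.toMatrix b b s).det ≠ 0 := by
    rintro _ ⟨g, _, rfl⟩
    rw [LinearMap.det_toMatrix, ← LinearEquiv.coe_det]; exact (LinearEquiv.det g).ne_zero
  have hQS : ∀ s ∈ (fun h : W ≃ₗ[ℂ] W => (h : Module.End ℂ W)) '' (Δ : Set (W ≃ₗ[ℂ] W)),
      evalAtInvDet (LinearMap.toMatrix b b s) Q = 0 := by
    rintro _ ⟨g, hgΔ, rfl⟩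
    rw [hQ g (hΔ g hgΔ), Complex.ofReal_eq_zero]
    exact hP _ ⟨restrictScalarsRealHom W g, Subgroup.mem_map_of_mem _ hgΔ, rfl⟩
  have hudet : (LinearMap.toMatrix b b (u : Module.End ℂ W)).det ≠ 0 := by
    rw [LinearMap.det_toMatrix, ← LinearEquiv.coe_det]; exact (LinearEquiv.det u).ne_zero
  have h := evalAtInvDet_eq_zero_of_mem b hmem hudet hdetS Q hQS
  rw [hQ u hu, Complex.ofReal_eq_zero] at h
  exact h

end Transfer

end Literature.AlgebraicGeometry.HodgeTheory
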